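import Mathlib
import Summits.ResolutionOfSingularities.ResolutionOfSingularities.Theorems.WeightedInvariantLocalWeightedDropMonicDescentVertexPersistence
import Summits.ResolutionOfSingularities.ResolutionOfSingularities.Theorems.WeightedInvariantLocalWeightedDropMonicDescentStrategy
import Summits.ResolutionOfSingularities.ResolutionOfSingularities.Theorems.WeightedInvariantLocalWeightedDropMonicDescentInvariantLaws

/-!
# `WeightedInvariant.LocalWeightedDrop`, sub-stub N4″: a well-preparing re-centring keeps `(α, β)` when the lex-min vertex is odd (tool for T-5′)

Crux item stmt-ResolutionOfSingularities-8899 `LocalWeightedDrop` (route `ResolutionOfSingularities/WeightedInvariant`), door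
`WeightedConstruction` stmt-ResolutionOfSingularities-0571.  [OURS · L1 W4.3, chain w43, lead prover; tool for piece T-5′ (`stub_monicDescentNoChain`)
of `N4PRIME-PLAN.md`.  MODEL: Cossart–Jannsen–Saito LNM 2270 Lemma 11.4 (1) ("for a preparation `(f,y,u) → (g,z,u)` at a vertex … `β(f,y,u) =
β(g,z,u)`" for `v`-prepared labels), here for pairs over `k̄[[u₁,u₂]]` in characteristic 2 and ANY well-preparing re-centring
(`MonicDescent.IsPrepRecentring`), via the vertex-persistence lemma `exists_low_exponent_of_recentre` (p486315).]

* `two_eq_zero`, `recentre_snd_eq` (`A₁ + 2ψ = A₁`), `recentre_recentre_fst` (re-centring twice by `ψ` is the identity in char 2);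
* `isVertex_lexMin` — the lex-min point `(2α, 2β)` of a scaled Newton set is a vertex (weight `(2β + 1, 1)`);
* `alphaL_recentre_eq`, `betaL_recentre_eq` — if the lex-min point of `newtonSet A₀ A₁` is ODD and `ψ` is a well-preparing re-centring, the
  re-centred label has the same `2α` and `2β`.
-/

set_option linter.dupNamespace false -- mandated namespace of this single-conjunct summit

noncomputable section

namespace Summit.ResolutionOfSingularities.ResolutionOfSingularities.Theorems

namespace MonicDescent

open MvPowerSeries

variable {k : Type} [Field k] [CharP k 2]

/-- `2 = 0` in `k[[u]]` over a field of characteristic 2. -/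
theorem two_eq_zero {m : ℕ} : (2 : MvPowerSeries (Fin m) k) = 0 := by
  have h : ((2 : ℕ) : MvPowerSeries (Fin m) k) = 0 := by
    rw [← map_natCast (C : k →+* MvPowerSeries (Fin m) k) 2, CharP.cast_eq_zero, map_zero]
  simpa using h

/-- In characteristic 2 the second component of a re-centred label is `A₁`. -/
theorem recentre_snd_eq {m : ℕ} (ψ A₀ A₁ : MvPowerSeries (Fin m) k) : (recentre ψ A₀ A₁).2 = A₁ := by
  change A₁ + 2 * ψ = A₁
  rw [two_eq_zero, zero_mul, add_zero]

/-- In characteristic 2, re-centring twice by the same `ψ` is the identity on `A₀`. -/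
theorem recentre_recentre_fst {m : ℕ} (ψ A₀ A₁ : MvPowerSeries (Fin m) k) :
    (recentre ψ A₀ A₁).1 + (recentre ψ A₀ A₁).2 * ψ + ψ ^ 2 = A₀ := by
  rw [recentre_snd_eq]
  change A₀ + A₁ * ψ + ψ ^ 2 + A₁ * ψ + ψ ^ 2 = A₀
  have h2 : (2 : MvPowerSeries (Fin m) k) = 0 := two_eq_zero
  linear_combination (A₁ * ψ + ψ ^ 2) * h2

omit [CharP k 2] in
/-- The LEX-MIN point `(2α, 2β)` of a point set is a vertex (exposed by the weight `(2β + 1, 1)`). -/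
theorem isVertex_lexMin {N : Set (Fin 2 →₀ ℕ)} {P : Fin 2 →₀ ℕ} (hP : P ∈ N) (h0 : P 0 = alphaL N) (h1 : P 1 = betaL N) :
    IsVertex N P := by
  refine ⟨hP, fun i => if i = 0 then betaL N + 1 else 1, fun i => by fin_cases i <;> simp, fun Q hQ hne => ?_⟩
  have hw : ∀ R : Fin 2 →₀ ℕ, Finsupp.weight (fun i : Fin 2 => if i = 0 then betaL N + 1 else 1) R = (betaL N + 1) * R 0 + R 1 := by
    intro R
    rw [Finsupp.weight_apply, Finsupp.sum_fintype _ _ (by simp)]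
    simp [Fin.sum_univ_two]
    ring
  rw [hw, hw, h0, h1]
  have hQ0 := alphaL_le hQ
  rcases Nat.lt_or_ge (alphaL N) (Q 0) with hlt | hge
  · nlinarith
  · have hQ0eq : Q 0 = alphaL N := le_antisymm hge hQ0
    have hQ1 := betaL_le hQ hQ0eq
    have hne1 : Q 1 ≠ betaL N := by
      intro h
      apply hne
      exact Literature.RingTheory.TwoVariableSeries.finsupp_fin2_ext (hQ0eq.trans h0.symm) (h.trans h1.symm)
    rw [hQ0eq]
    omega

/-- If the lex-min point of `N(A₀, A₁)` is ODD and `ψ` is a well-preparing re-centring, then `2α` is unchanged.  (`≤`: the odd vertex persists by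
the persistence clause; `≥`: a new point left of `2α` would give an odd vertex of the (well-prepared) new label left of `2α`, which by
`exists_low_exponent_of_recentre` (re-centring back by `ψ`, an involution in char 2) would produce a point of `N(A₀, A₁)` left of `2α`.) -/
theorem alphaL_recentre_eq {A₀ A₁ ψ : MvPowerSeries (Fin 2) k} (hprep : IsPrepRecentring A₀ A₁ ψ) {P : Fin 2 →₀ ℕ}
    (hP : P ∈ newtonSet A₀ A₁) (h0 : P 0 = alphaL (newtonSet A₀ A₁)) (h1 : P 1 = betaL (newtonSet A₀ A₁)) (hodd : IsOdd A₀ A₁ P) :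
    alphaL (newtonSet (recentre ψ A₀ A₁).1 (recentre ψ A₀ A₁).2) = alphaL (newtonSet A₀ A₁) := by
  obtain ⟨hψ0, -, hWP, hpers⟩ := hprep
  set B₀ := (recentre ψ A₀ A₁).1 with hB₀
  have hB₁ : (recentre ψ A₀ A₁).2 = A₁ := recentre_snd_eq ψ A₀ A₁
  rw [hB₁] at hWP hpers ⊢
  obtain ⟨hvert', hcoef⟩ := hpers P (isVertex_lexMin hP h0 h1) hodd
  -- `P` lies in the new Newton set
  have hP' : P ∈ newtonSet B₀ A₁ := hvert'.1
  apply le_antisymm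
  · rw [← h0]; exact alphaL_le hP'
  · -- no new point left of `2α`
    by_contra hlt
    push Not at hlt
    have hne' : (newtonSet B₀ A₁).Nonempty := ⟨P, hP'⟩
    obtain ⟨Q, hQ, hQ0, hQ1⟩ := exists_eq_betaL hne'
    have hQv : IsVertex (newtonSet B₀ A₁) Q := isVertex_lexMin hQ hQ0 hQ1
    have hQodd : IsOdd B₀ A₁ Q := hWP Q hQv
    have hQlt : Q 0 < alphaL (newtonSet A₀ A₁) := by rw [hQ0]; exact hlt
    rcases hQodd with ⟨e, rfl, he⟩ | ⟨hQc, hQi⟩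
    · -- an `A₁`-point: already in the old Newton set
      have := alphaL_le (N := newtonSet A₀ A₁) (P := 2 • e) (Or.inr ⟨e, rfl, he⟩)
      omega
    · -- an odd `A₀`-point of the new label: re-centre back by `ψ`
      by_cases hA1pt : ∃ e : Fin 2 →₀ ℕ, Q = 2 • e ∧ coeff e A₁ ≠ 0
      · obtain ⟨e, rfl, he⟩ := hA1pt
        have := alphaL_le (N := newtonSet A₀ A₁) (P := 2 • e) (Or.inr ⟨e, rfl, he⟩)
        omega
      push Not at hA1pt
      set L : ℕ := Q 1 + 1 with hL
      set w : Fin 2 → ℕ := fun i => if i = 0 then L else 1 with hw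
      have hweight : ∀ d : Fin 2 →₀ ℕ, Finsupp.weight w d = L * d 0 + d 1 := by
        intro d
        rw [Finsupp.weight_apply, Finsupp.sum_fintype _ _ (by simp)]
        simp [Fin.sum_univ_two, hw]
        ring
      obtain ⟨d, hd, hdle⟩ := exists_low_exponent_of_recentre w B₀ A₁ ψ Q hQc hQi
        (fun d hd => by
          rw [hweight, hweight]
          have hd0 := alphaL_le (N := newtonSet B₀ A₁) (Or.inl hd)
          rcases Nat.lt_or_ge (Q 0) (d 0) with hlt' | hge
          · nlinarith
          · have hd0eq : d 0 = alphaL (newtonSet B₀ A₁) := by omega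
            have := betaL_le (N := newtonSet B₀ A₁) (Or.inl hd) hd0eq
            rw [hQ0, hQ1]; rw [hd0eq]; omega)
        (fun a ha => by
          rw [hweight, hweight]
          have hmem : (2 • a) ∈ newtonSet B₀ A₁ := Or.inr ⟨a, rfl, ha⟩
          have ha0 := alphaL_le hmem
          simp only [Finsupp.smul_apply, smul_eq_mul] at ha0
          rcases Nat.lt_or_ge (Q 0) (2 * a 0) with hlt' | hge
          · nlinarith
          · have ha0eq : (2 • a) 0 = alphaL (newtonSet B₀ A₁) := by
              simp only [Finsupp.smul_apply, smul_eq_mul]; omega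
            have ha1 := betaL_le hmem ha0eq
            simp only [Finsupp.smul_apply, smul_eq_mul] at ha1
            have hne2 : 2 • a ≠ Q := fun h => ha (hA1pt a h.symm)
            have hne1 : 2 * a 1 ≠ Q 1 := by
              intro h
              apply hne2
              exact Literature.RingTheory.TwoVariableSeries.finsupp_fin2_ext
                (by simp only [Finsupp.smul_apply, smul_eq_mul]; omega) (by simp only [Finsupp.smul_apply, smul_eq_mul]; omega)
            have h2a0 : 2 * a 0 = Q 0 := by omega
            have hQ1le : Q 1 ≤ 2 * a 1 := by rw [hQ1]; exact ha1
            have hexp : 2 * (L * a 0 + a 1) = L * (2 * a 0) + 2 * a 1 := by ring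
            rw [hexp, h2a0]
            omega)
      -- `d` is an exponent of `A₀` (re-centring back is the identity in characteristic 2) left of `2α`
      have hback : B₀ + A₁ * ψ + ψ ^ 2 = A₀ := by
        rw [hB₀]
        change A₀ + A₁ * ψ + ψ ^ 2 + A₁ * ψ + ψ ^ 2 = A₀
        have h2 : (2 : MvPowerSeries (Fin 2) k) = 0 := two_eq_zero
        linear_combination (A₁ * ψ + ψ ^ 2) * h2
      rw [hback] at hd
      have hdmem : d ∈ newtonSet A₀ A₁ := Or.inl hd
      have hd0 := alphaL_le hdmem
      rw [hweight, hweight] at hdle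
      have : d 0 ≤ Q 0 := by
        by_contra hgt
        push Not at hgt
        nlinarith
      omega

/-- Under the same hypotheses `2β` is unchanged: the odd lex-min vertex `P = (2α, 2β)` persists as a vertex of the new Newton set, so no new
point of the column `2α` lies below it. -/
theorem betaL_recentre_eq {A₀ A₁ ψ : MvPowerSeries (Fin 2) k} (hprep : IsPrepRecentring A₀ A₁ ψ) {P : Fin 2 →₀ ℕ}
    (hP : P ∈ newtonSet A₀ A₁) (h0 : P 0 = alphaL (newtonSet A₀ A₁)) (h1 : P 1 = betaL (newtonSet A₀ A₁)) (hodd : IsOdd A₀ A₁ P) :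
    betaL (newtonSet (recentre ψ A₀ A₁).1 (recentre ψ A₀ A₁).2) = betaL (newtonSet A₀ A₁) := by
  have hα := alphaL_recentre_eq hprep hP h0 h1 hodd
  obtain ⟨hψ0, -, hWP, hpers⟩ := hprep
  obtain ⟨hvert', hcoef⟩ := hpers P (isVertex_lexMin hP h0 h1) hodd
  have hP' := hvert'.1
  apply le_antisymm
  · rw [← h1]
    exact betaL_le hP' (by rw [hα]; exact h0)
  · by_contra hlt
    push Not at hlt
    obtain ⟨Q, hQ, hQ0, hQ1⟩ := exists_eq_betaL (N := newtonSet (recentre ψ A₀ A₁).1 (recentre ψ A₀ A₁).2) ⟨P, hP'⟩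
    -- `Q` is strictly below `P` on the same column: `P` cannot be a vertex
    obtain ⟨-, w, hw, hmin⟩ := hvert'
    have hne : Q ≠ P := by
      intro h
      rw [h, h1] at hQ1
      omega
    have hlt' := hmin Q hQ hne
    have hwt : ∀ R : Fin 2 →₀ ℕ, Finsupp.weight w R = w 0 * R 0 + w 1 * R 1 := by
      intro R
      rw [Finsupp.weight_apply, Finsupp.sum_fintype _ _ (by simp)]
      simp [Fin.sum_univ_two]
      ring
    rw [hwt, hwt] at hlt'
    have hQ0' : Q 0 = P 0 := by rw [hQ0, hα, h0]
    rw [hQ0'] at hlt'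
    have hQ1lt : Q 1 < P 1 := by rw [hQ1, h1]; exact hlt
    have := hw 1
    nlinarith

end MonicDescent

end Summit.ResolutionOfSingularities.ResolutionOfSingularities.Theorems

end
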